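import Mathlib
import Summits.QuantumFields.YangMills.Theorems.TransverseWardBLCutEstimate
import Summits.QuantumFields.YangMills.Theorems.TransverseWardBLConvexPhaseCalculus
import Summits.QuantumFields.YangMills.Theses.TransverseWardBL
import HarnessLib

/-!
# `TransverseWardBL.ConvexPhaseCoexactBound` (crux stmt-QuantumFields-23103): the transverse Brascamp–Lieb
# bound in the convex small-field phase of Wilson `U(1)₄`, for every torus and every `β > 0`

Route `TransverseWardBL` of `QuantumFields/YangMills` (LINE g9-C of the ideator seat ym-idea-4, card
«spectral / trace methods»; an abelian `U(1)` line onto the leaf `Theorems.U1HelicityGapTorusD4` — NOT a rung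
toward `YangMills`; nothing here bears on the Yang–Mills mass gap).  The crux `ConvexPhaseCoexactBound`:
for `β > β₁ := 0`, every torus `(ℤ/(M+1))⁴` and every co-closed plaquette form `u` with vanishing orientation
sums, `0 < ⟨1_G⟩` and `β ⟨f_u² 1_G⟩ ≤ (9/20) |u|² ⟨1_G⟩`, where `G = {∀ p, cos 1 ≤ Re U_p}` is the small-field
cut and `f_u = Σ_p u_p Im U_p`.

Proof (`convexPhaseCoexactBound_proof`): in Lüscher's plaquette angles `ω = plaqAngle`, `Re U_p = cos ω_p`,
`Im U_p = sin ω_p`, the cut is `{∀ p, |ω_p| ≤ 1}` and the Wilson density is `e^{−β|P|} e^{βΣcos ω}`; the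
co-closedness hypothesis makes `u` transverse to `V = im d`; so everything reduces to the Haar-measure
statement `cut_estimate` (`TransverseWardBLCutEstimate`: sector chart + per-sector Brascamp–Lieb/Bobkov–Ledoux
Poincaré bound `(1 − cos 1)²/(β cos 1)` + zero sector means + sum over the flux sectors `k ∈ ℤ⁶`), and the
numerical inequality `(1 − cos 1)² ≤ (9/20) cos 1` (`one_sub_cos_one_sq_le`).
-/

noncomputable section

open scoped BigOperators ENNReal
open MeasureTheory Finset Set
open Literature.MathematicalPhysics.QuantumLattice Literature.MathematicalPhysics.QuantumFieldTheory
open Summit.QuantumFields.YangMills.Theorems.SelfNormalisedSkewness.Negative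

namespace Summit.QuantumFields.YangMills.Theorems.TransverseWardBL

variable {S : ℕ} [NeZero S]

/-! ### Plaquette variables in terms of the plaquette angles -/

omit [NeZero S] in
/-- `Re U_p = cos ω_p(U)`. [folklore] -/
theorem re_plaquette_eq_cos (U : GaugeConfig 4 S Circle) (p : Plaquette 4 S) :
    ((plaquetteHolonomy U p.1 p.2.1.1 p.2.1.2 : Circle) : ℂ).re = Real.cos (plaqAngle U p) := by
  rw [plaqAngle_apply, ← exp_abelianFieldTensor U p.1 p.2.1.1 p.2.1.2, Circle.coe_exp,
    Complex.exp_ofReal_mul_I_re]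

omit [NeZero S] in
/-- `Im U_p = sin ω_p(U)`. [folklore] -/
theorem im_plaquette_eq_sin (U : GaugeConfig 4 S Circle) (p : Plaquette 4 S) :
    ((plaquetteHolonomy U p.1 p.2.1.1 p.2.1.2 : Circle) : ℂ).im = Real.sin (plaqAngle U p) := by
  rw [plaqAngle_apply, ← exp_abelianFieldTensor U p.1 p.2.1.1 p.2.1.2, Circle.coe_exp,
    Complex.exp_ofReal_mul_I_im]

omit [NeZero S] in
/-- **The cut in angle form**: `cos 1 ≤ cos ω_p ↔ |ω_p| ≤ 1` (since `ω_p ∈ (−π, π]`). [folklore] -/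
theorem cos_one_le_iff_abs_plaqAngle_le (U : GaugeConfig 4 S Circle) (p : Plaquette 4 S) :
    Real.cos 1 ≤ ((plaquetteHolonomy U p.1 p.2.1.1 p.2.1.2 : Circle) : ℂ).re ↔ |plaqAngle U p| ≤ 1 := by
  rw [re_plaquette_eq_cos]
  constructor
  · intro h
    by_contra hlt
    push Not at hlt
    have hπ : |plaqAngle U p| ≤ Real.pi := by
      rw [plaqAngle_apply]; exact abs_abelianFieldTensor_le_pi U p.1 p.2.1.1 p.2.1.2
    have := Real.cos_lt_cos_of_nonneg_of_le_pi (by norm_num) hπ hlt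
    rw [Real.cos_abs] at this
    linarith
  · exact cos_one_le_cos_of_abs_le

/-! ### Co-closed forms are transverse to `V = im d` -/

/-- **Co-closedness ⇒ transversality**: if `Σ_p u_p (d δ_e)_p = 0` for every edge indicator `δ_e`, then
`Σ_p u_p w_p = 0` for every exact `w ∈ im d` (linearity: the `δ_e` span all link fields). [folklore] -/
theorem transverse_of_coclosed (u : Plaquette 4 S → ℝ)
    (hco : ∀ e : Edge 4 S, ∑ p : Plaquette 4 S, u p * LatticeForm.res (LatticeForm.td₁
      (fun (y : Site 4 S) (k : Fin 4) => if y = e.1 ∧ k = e.2 then (1 : ℝ) else 0)) p = 0) :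
    ∀ w ∈ LinearMap.range (plaqCoboundary S), ∑ p : Plaquette 4 S, u p * (w : EuclideanSpace ℝ (Plaquette 4 S)) p = 0 := by
  classical
  -- the scalar functional `θ ↦ Σ_p u_p (dθ)_p`
  set Λ : (Edge 4 S → ℝ) →ₗ[ℝ] ℝ :=
    { toFun := fun θ => ∑ p : Plaquette 4 S, u p * plaqCoboundary S θ p
      map_add' := fun θ θ' => by
        simp only [map_add, PiLp.add_apply, mul_add, Finset.sum_add_distrib]
      map_smul' := fun a θ => by
        simp only [map_smul, PiLp.smul_apply, smul_eq_mul, RingHom.id_apply, Finset.mul_sum]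
        exact Finset.sum_congr rfl fun p _ => by ring } with hΛ
  have hbasis : ∀ e : Edge 4 S, Λ (Pi.basisFun ℝ (Edge 4 S) e) = 0 := by
    intro e
    rw [Pi.basisFun_apply]
    simp only [hΛ, LinearMap.coe_mk, AddHom.coe_mk]
    rw [← hco e]
    refine Finset.sum_congr rfl fun p _ => ?_
    congr 1
    obtain ⟨x, ⟨⟨i, j⟩, hij⟩⟩ := p
    simp only [plaqCoboundary_apply, LatticeForm.res, LatticeForm.td₁, LatticeForm.te, Pi.single_apply,
      Prod.ext_iff]
  have hΛ0 : Λ = 0 := (Pi.basisFun ℝ (Edge 4 S)).ext fun e => by rw [hbasis e, LinearMap.zero_apply]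
  rintro w ⟨θ, rfl⟩
  have := congrArg (fun L : (Edge 4 S → ℝ) →ₗ[ℝ] ℝ => L θ) hΛ0
  simpa [hΛ] using this

/-! ### The crux -/

/-- **`ConvexPhaseCoexactBound` holds** (crux stmt-QuantumFields-23103 of route `TransverseWardBL`), with
`β₁ = 0`: for every `β > 0`, every torus `(ℤ/(M+1))⁴`, and every co-closed plaquette form `u` with vanishing
orientation sums, `0 < ⟨1_G⟩_{β,M}` and `β ⟨f_u² 1_G⟩_{β,M} ≤ (9/20) (Σ u_p²) ⟨1_G⟩_{β,M}` — in fact with the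
sharper constant `(1 − cos 1)²/cos 1 = 0.391…`: Brascamp–Lieb on each convex flux sector of the cut, zero sector
means by translation invariance, no toron-sector weights needed. [folklore] -/
theorem convexPhaseCoexactBound_proof :
    Summit.QuantumFields.YangMills.Theses.TransverseWardBL.ConvexPhaseCoexactBound := by
  classical
  refine ⟨0, fun β hβ M u hco hzs => ?_⟩
  beta_reduce
  -- notation
  set μH : Measure (GaugeConfig 4 (M + 1) Circle) := Measure.pi fun _ : Edge 4 (M + 1) => haarProbability Circle
    with hμH
  set G : Set (GaugeConfig 4 (M + 1) Circle) := {U | ∀ p : Plaquette 4 (M + 1), |plaqAngle U p| ≤ 1} with hG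
  set W : GaugeConfig 4 (M + 1) Circle → ℝ := fun U =>
    Real.exp (β * ∑ q : Plaquette 4 (M + 1), Real.cos (plaqAngle U q)) with hW
  set fU : GaugeConfig 4 (M + 1) Circle → ℝ := fun U =>
    ∑ p : Plaquette 4 (M + 1), u p * Real.sin (plaqAngle U p) with hfU
  set C₀ : ℝ := Real.exp (-β * Fintype.card (Plaquette 4 (M + 1))) with hC₀
  have hC₀pos : 0 < C₀ := Real.exp_pos _
  -- the Wilson density in angle form
  have hdens : ∀ U : GaugeConfig 4 (M + 1) Circle, Real.exp (-β * wilsonAction u1Rep U) = C₀ * W U := by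
    intro U
    rw [wilsonAction_u1_eq_sum_plaqAngle, hC₀, hW, ← Real.exp_add]
    congr 1
    rw [Finset.sum_sub_distrib, Finset.sum_const, Finset.card_univ, nsmul_eq_mul, mul_one]
    ring
  -- the indicator and the test functional in angle form
  have hind : ∀ U : GaugeConfig 4 (M + 1) Circle,
      (if (∀ p : Plaquette 4 (M + 1), Real.cos 1 ≤
        ((plaquetteHolonomy U p.1 p.2.1.1 p.2.1.2 : Circle) : ℂ).re) then (1 : ℝ) else 0) =
      G.indicator (fun _ => (1 : ℝ)) U := by
    intro U
    have hiff : (∀ p : Plaquette 4 (M + 1), Real.cos 1 ≤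
        ((plaquetteHolonomy U p.1 p.2.1.1 p.2.1.2 : Circle) : ℂ).re) ↔ U ∈ G := by
      simp only [hG, Set.mem_setOf_eq, cos_one_le_iff_abs_plaqAngle_le]
    by_cases hU : U ∈ G
    · rw [if_pos (hiff.2 hU), Set.indicator_of_mem hU]
    · rw [if_neg (fun h => hU (hiff.1 h)), Set.indicator_of_notMem hU]
  have hf : ∀ U : GaugeConfig 4 (M + 1) Circle,
      (∑ p : Plaquette 4 (M + 1), u p * ((plaquetteHolonomy U p.1 p.2.1.1 p.2.1.2 : Circle) : ℂ).im) = fU U := by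
    intro U; simp only [hfU, im_plaquette_eq_sin]
  -- the three Haar integrals
  set A₀ : ℝ := ∫ U, G.indicator W U ∂μH with hA₀
  set A₂ : ℝ := ∫ U, G.indicator (fun U => fU U ^ 2 * W U) U ∂μH with hA₂
  set Z : ℝ := ∫ U, W U ∂μH with hZ
  have hWm : Measurable W := Real.measurable_exp.comp ((Finset.measurable_sum _ fun q _ =>
    Real.measurable_cos.comp (measurable_plaqAngle_apply q)).const_mul β)
  have hWb : ∀ U, W U ≤ Real.exp (|β| * Fintype.card (Plaquette 4 (M + 1))) := fun U =>
    exp_mul_sum_cos_le β (plaqAngle U)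
  have hWpos : ∀ U, 0 < W U := fun U => Real.exp_pos _
  have hWi : Integrable W μH :=
    Integrable.of_bound hWm.aestronglyMeasurable (Real.exp (|β| * Fintype.card (Plaquette 4 (M + 1))))
      (ae_of_all _ fun U => by rw [Real.norm_eq_abs, abs_of_pos (hWpos U)]; exact hWb U)
  have hZpos : 0 < Z := integral_exp_pos hWi
  -- transversality of `u` and the cut estimate
  have huV := transverse_of_coclosed (S := M + 1) u hco
  obtain ⟨hcut, hA₀pos⟩ := cut_estimate (S := M + 1) hβ u hzs huV
  change A₂ ≤ (1 - Real.cos 1) ^ 2 / (β * Real.cos 1) * (∑ p, u p ^ 2) * A₀ at hcut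
  change 0 < A₀ at hA₀pos
  -- rewrite the Wilson expectations as Haar integrals
  simp only [wilsonExpectation_eq_div_integral u1Rep continuous_u1Rep, hind, hf, hdens]
  have i0 : ∫ U, C₀ * W U ∂μH = C₀ * Z := integral_const_mul _ _
  have i1 : ∫ U, G.indicator (fun _ => (1 : ℝ)) U * (C₀ * W U) ∂μH = C₀ * A₀ := by
    rw [hA₀, ← integral_const_mul]
    refine integral_congr_ae (ae_of_all _ fun U => ?_)
    by_cases hU : U ∈ G
    · simp only [Set.indicator_of_mem hU, one_mul]
    · simp only [Set.indicator_of_notMem hU, zero_mul, mul_zero]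
  have i2 : ∫ U, fU U ^ 2 * G.indicator (fun _ => (1 : ℝ)) U * (C₀ * W U) ∂μH = C₀ * A₂ := by
    rw [hA₂, ← integral_const_mul]
    refine integral_congr_ae (ae_of_all _ fun U => ?_)
    by_cases hU : U ∈ G
    · simp only [Set.indicator_of_mem hU, mul_one]; ring
    · simp only [Set.indicator_of_notMem hU, mul_zero, zero_mul]
  rw [i0, i1, i2, mul_div_mul_left _ _ hC₀pos.ne', mul_div_mul_left _ _ hC₀pos.ne']
  -- constants
  have hcos1 : 0 < Real.cos 1 := Real.cos_pos_of_mem_Ioo ⟨by linarith [Real.pi_gt_three], by linarith [Real.pi_gt_three]⟩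
  have hSu : 0 ≤ ∑ p, u p ^ 2 := Finset.sum_nonneg fun p _ => sq_nonneg _
  have hnum : (1 - Real.cos 1) ^ 2 / Real.cos 1 ≤ 9 / 20 := by
    rw [div_le_iff₀ hcos1]
    exact one_sub_cos_one_sq_le
  refine ⟨div_pos hA₀pos hZpos, ?_⟩
  have hβK : β * ((1 - Real.cos 1) ^ 2 / (β * Real.cos 1)) = (1 - Real.cos 1) ^ 2 / Real.cos 1 := by
    field_simp
  have h1 : β * A₂ ≤ 9 / 20 * (∑ p, u p ^ 2) * A₀ := by
    have h2 := mul_le_mul_of_nonneg_left hcut hβ.le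
    have h3 : β * ((1 - Real.cos 1) ^ 2 / (β * Real.cos 1) * (∑ p, u p ^ 2) * A₀) =
        (1 - Real.cos 1) ^ 2 / Real.cos 1 * ((∑ p, u p ^ 2) * A₀) := by
      rw [← hβK]; ring
    rw [h3] at h2
    have h4 : (1 - Real.cos 1) ^ 2 / Real.cos 1 * ((∑ p, u p ^ 2) * A₀) ≤ 9 / 20 * ((∑ p, u p ^ 2) * A₀) :=
      mul_le_mul_of_nonneg_right hnum (mul_nonneg hSu hA₀pos.le)
    linarith
  rw [← mul_div_assoc, ← mul_div_assoc]
  exact div_le_div_of_nonneg_right h1 hZpos.le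

end Summit.QuantumFields.YangMills.Theorems.TransverseWardBL

end
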